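import Summits.CriticalPhenomena.PercolationContinuityZ3.Theses.PercSubharmonicSquare
import Literature.Probability.Percolation.ContinuityCriterion

/-!
# Route PercSubharmonicSquare — support item `SubcritConnectivityVanishes`

For every `p < p_c(ℤ³)` the two-point function `τ_p(0,x)` tends to `0` as `x → ∞` (cofinite
filter on `ℤ³`). This is known mathematics (Grimmett 1999, §1.4 (1.11): `θ(p) = 0` below `p_c`
by the definition of `p_c` as an infimum; and `τ_p(0,x) ≤ P_p(0 ↔ ∂Λ_n) ↓ θ(p)`, first exit from
the box, §1.4/§8.5) and is proved in the tree as
`Literature.Probability.Percolation.tendsto_tau_cofinite_of_theta_eq_zero` composed with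
`Literature.Probability.Percolation.theta_eq_zero_of_lt_criticalProb_holds`. The route file keeps
these out of its own import closure (cone hygiene); this Theorems file discharges the hypothesis
`hV` of `closes`.
-/

namespace Summit.CriticalPhenomena.PercolationContinuityZ3.Theorems

open Literature.Probability.Percolation Literature.Probability.LatticeModels

/-- **Subcritical connectivity vanishes at infinity** (support item stmt-CriticalPhenomena-11638 of
route PercSubharmonicSquare): for every `p < p_c(ℤ³)`, `τ_p(0,x) → 0` along the cofinite filter.
Proof: `θ(p) = 0` for `p < p_c` (Grimmett 1999 §1.4 (1.11),
`theta_eq_zero_of_lt_criticalProb_holds`), and `θ(p) = 0 ⟹ τ_p(0,·) → 0`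
(`tendsto_tau_cofinite_of_theta_eq_zero`, Grimmett 1999 §1.4, §8.5). -/
theorem subcritConnectivityVanishes_proof :
    Summit.CriticalPhenomena.PercolationContinuityZ3.Theses.PercSubharmonicSquare.SubcritConnectivityVanishes := by
  unfold Summit.CriticalPhenomena.PercolationContinuityZ3.Theses.PercSubharmonicSquare.SubcritConnectivityVanishes
  intro p hp
  exact tendsto_tau_cofinite_of_theta_eq_zero p
    (theta_eq_zero_of_lt_criticalProb_holds (zdGraph 3) (0 : Site 3) p hp)

end Summit.CriticalPhenomena.PercolationContinuityZ3.Theorems
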